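import Summits.Ventures.HSemireg.SignedPureWeilLadder

/-!
# Venture HSemireg — THE TWISTED-ORBIT LEMMA for signed pure-Weil designs (every n): a design on (ℤ∕4)ⁿ⁺¹ with a twisted
# translation symmetry `m(x + (1, w)) = c·m(x)` (c = ±1) is the orbit of its slice `q = m(0, ·)`, its moments are
# `m̂(t, ε') = (1 + ρ + ρ² + ρ³)·q̂(ε')` with `ρ = c·i^{c_t + ε'·w}`, so it is pure iff `q` satisfies the RELAXED conditions
# «q̂(ε') = 0 unless ρ ≠ 1», and it has exactly 4·#supp q letters — the mechanism behind s(4) = 28 = 4·7 and s(5) ≤ 84 = 4·21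

HONEST FRAMING. Part of the Lean index of the computation cell `pub-hsemireg` (Sunday typer seat p9, § g = 8; family B row **B20-3**
of `target-g8/CENSUS.md`: signed pure-Weil unit-graph designs are «class witnesses — cycles with ℤ-coefficients — not census objects»).
FINITE GAUSSIAN-INTEGER ARITHMETIC ONLY, in the vocabulary of `SignedPureWeilLadder.lean` (`Letter`, `Eps`, `coef`, `unitTab`, `expo`,
`vchi`, `vmoment`, `G`, `plus`, `minus`, `supp`, `sliceSupp`). No abelian variety, cycle, sheaf or semiregularity map is constructed;
t-20's dictionary (LEMMA W) is text of record, not a binder; nothing here says that HC ∕ HC_CM ∕ HC_AV holds; no object is certified; no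
Literature fact is declared; no verdict ∕ door word ∕ count of the cell moves.

WHAT THIS FILE PROVES. §0 (every n, every `w ∈ (ℤ∕4)ⁿ`, every integer `c`) **`vmoment_eq_zero_of_shift_eq_smul`**: if
`m(x + w) = c·m(x)` for all `x` and `i^{−ε·w} ≠ c` then `m̂(ε) = 0` — a twisted translation symmetry makes a design AUTOMATICALLY pure off
the set `{ε : i^{−ε·w} = c}` (a W-alive design can carry it only with `c = i^{−Σw} = ±1`, Σw even). Then, for the symmetries with a
coordinate equal to 1 (every n; `m : Letter (n+1) → ℤ`, `w : Letter n`, `c = ±1`, HYPOTHESIS `hsym : ∀ x, m (x + (1, w)) = c·m(x)`,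
`q := slice0 m = m(0, ·)`):
§1 `G_succ_of_sym` ∕ `G_eq_pow_mul` — the slice moments form a geometric progression `G(b) = (c·i^{ε'·w})^b · q̂(ε')`; with the
partial transform `vmoment_cons` of the Ladder file this gives **`vmoment_of_sym`**: `m̂(t, ε') = (Σ_{b<4} ρ^b)·q̂(ε')`,
`ρ = c·i^{c_t + ε'·w}` (`rho`), and `rho_pow_four` (ρ⁴ = 1), `geom_four_eq_zero` (ρ ≠ 1 ⇒ 1 + ρ + ρ² + ρ³ = 0, ℤ[i] a domain).
§2 **`pure_iff_of_sym`**: `m` is pure iff for every visible `(t, ε')` either `ρ ≠ 1` or `q̂(ε') = 0` — the RELAXED design conditions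
on the slice (the patterns with `ρ ≠ 1` impose nothing on `q`); **`vmoment_plus_of_sym`**: if `c·i^{1 + Σw} = 1` then
`m̂(+,…,+) = 4·q̂(+,…,+)` (so `m` is W-alive iff `q` is); **`card_supp_of_sym`**: `#supp m = 4·#supp q`.
§3 **`twistedOrbit q w c`** = the explicit orbit `(j, y) ↦ c^j·q(y − j·w)` with `twistedOrbit_sym` (it satisfies `hsym` when
`c = ±1`) and `slice0_twistedOrbit` (its slice is `q`): so **every relaxed q on (ℤ∕4)ⁿ gives a pure design on (ℤ∕4)ⁿ⁺¹ with 4·#supp q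
letters** (`exists_pure_of_relaxed`) — an (n → n+1) construction different from the tensor trick `s(a+b) ≤ 2·s(a)·s(b)`.
WHY IT MATTERS (numbers of record, not theorems of this file): every minimal 28-letter design on (ℤ∕4)⁴ has the twisted symmetry
`w = (1,1,3)`, `c = −1` and is the orbit of a 7-letter relaxed `q` on (ℤ∕4)³ (s(4) = 28 = 4·7 although s(3) = 14); the 84-letter design of
`SignedPureWeilFourierCertificate.lean` has `w = (1,2,3,3)`, `c = −1` and is the orbit of a 21-letter relaxed `q` on (ℤ∕4)⁴ (s(5) ≤ 84 = 4·21
although s(4) = 28 would give 112); a 96-letter one with `w = (3,1,3,0)`, `c = +1` (orbit of a 24-letter `q` that is itself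
antiperiodic under `(2,0,2,2)`) was the first found below the tensor bound.

WHAT IS NOT HERE. Minimal relaxed designs for any (n, w); the values s(5), s(6); LEMMA W; anything about sheaves or semiregularity.
-/

namespace Summit.Ventures.HSemireg.SignedWeilDesignN

open Finset

variable {n : ℕ}

/-! ## §0 Any twisted translation symmetry kills the moments off its coset (every n, every w) -/

/-- **THE TWISTED-TRANSLATION LEMMA.** If `m(x + w) = c·m(x)` for every `x` and the character value `i^{−ε·w}` is not `c`, then
`m̂(ε) = 0`: summing `m(x + w)·i^{ε·x}` over `x` gives `i^{−ε·w}·m̂(ε)` (re-index) and `c·m̂(ε)` (symmetry), and `ℤ[i]` is a domain. -/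
theorem vmoment_eq_zero_of_shift_eq_smul (m : Letter n → ℤ) (w : Letter n) (c : ℤ)
    (h : ∀ x, m (x + w) = c * m x) (ε : Eps n) (hne : vchi ε (-w) ≠ (c : GaussianInt)) : vmoment m ε = 0 := by
  have hchi : ∀ x : Letter n, vchi ε x = vchi ε (-w) * vchi ε (x + w) := by
    intro x
    rw [vchi, vchi, vchi, ← unitTab_add]
    congr 1
    simp only [expo, Pi.add_apply, Pi.neg_apply, mul_add, mul_neg, Finset.sum_add_distrib, Finset.sum_neg_distrib]
    abel
  have h1 : (∑ x, (m (x + w) : GaussianInt) * vchi ε x) = (c : GaussianInt) * vmoment m ε := by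
    unfold vmoment
    rw [Finset.mul_sum]
    refine Finset.sum_congr rfl (fun x _ => ?_)
    rw [h x, Int.cast_mul]
    ring
  have h2 : (∑ x, (m (x + w) : GaussianInt) * vchi ε x) = vchi ε (-w) * vmoment m ε := by
    unfold vmoment
    rw [Finset.mul_sum, ← Equiv.sum_comp (Equiv.addRight w) (fun x => vchi ε (-w) * ((m x : GaussianInt) * vchi ε x))]
    refine Finset.sum_congr rfl (fun x _ => ?_)
    simp only [Equiv.coe_addRight]
    rw [hchi x]
    ring
  have h3 : (vchi ε (-w) - (c : GaussianInt)) * vmoment m ε = 0 := by rw [sub_mul, ← h2, h1]; ring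
  rcases mul_eq_zero.mp h3 with h4 | h4
  · exact absurd (sub_eq_zero.mp h4) hne
  · exact h4

/-! ## §1 Slice moments of a design with a twisted translation symmetry -/

/-- The slice `q = m(0, ·)` of a design on (ℤ∕4)ⁿ⁺¹ along factor 0. [definition of this file] -/
def slice0 (m : Letter (n + 1) → ℤ) : Letter n → ℤ := fun y => m (Fin.cons 0 y)

/-- `G(0)` is the moment of the slice. -/
theorem G_zero_eq (m : Letter (n + 1) → ℤ) (ε' : Eps n) : G m ε' 0 = vmoment (slice0 m) ε' := rfl

/-- `(b, y) + (1, w) = (b + 1, y + w)` for prepended letters. -/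
theorem cons_add_cons_one (b : Fin 4) (y w : Letter n) :
    (Fin.cons b y : Letter (n + 1)) + Fin.cons 1 w = Fin.cons (b + 1) (y + w) := by
  funext k
  refine Fin.cases ?_ (fun i => ?_) k
  · simp
  · simp

/-- **The slice moments step by the ratio `c·i^{ε'·w}`:** `G(b+1) = c·i^{ε'·w}·G(b)` (re-index `y ↦ y + w`, then the symmetry). -/
theorem G_succ_of_sym (m : Letter (n + 1) → ℤ) (w : Letter n) (c : ℤ) (hsym : ∀ x, m (x + Fin.cons 1 w) = c * m x)
    (ε' : Eps n) (b : Fin 4) : G m ε' (b + 1) = (c : GaussianInt) * vchi ε' w * G m ε' b := by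
  -- `i^{ε'·(y + w)} = i^{ε'·y}·i^{ε'·w}` (this is `vchi_add` of `SignedPureWeilTransport.lean`, re-derived inline)
  have hva : ∀ y : Letter n, vchi ε' (y + w) = vchi ε' y * vchi ε' w := by
    intro y
    rw [vchi, vchi, vchi, ← unitTab_add]
    congr 1
    simp only [expo, Pi.add_apply, mul_add, Finset.sum_add_distrib]
  unfold G
  rw [← Equiv.sum_comp (Equiv.addRight w) (fun y => (m (Fin.cons (b + 1) y) : GaussianInt) * vchi ε' y)]
  rw [Finset.mul_sum]
  refine Finset.sum_congr rfl (fun y _ => ?_)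
  simp only [Equiv.coe_addRight]
  rw [← cons_add_cons_one, hsym, hva, Int.cast_mul]
  ring

/-- `G(b) = (c·i^{ε'·w})^b · q̂(ε')` for `b = 0, 1, 2, 3`. -/
theorem G_eq_pow_mul (m : Letter (n + 1) → ℤ) (w : Letter n) (c : ℤ) (hsym : ∀ x, m (x + Fin.cons 1 w) = c * m x)
    (ε' : Eps n) : ∀ b : Fin 4, G m ε' b = ((c : GaussianInt) * vchi ε' w) ^ b.val * vmoment (slice0 m) ε' := by
  have h1 : G m ε' 1 = ((c : GaussianInt) * vchi ε' w) * G m ε' 0 := by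
    simpa using G_succ_of_sym m w c hsym ε' 0
  have h2 : G m ε' 2 = ((c : GaussianInt) * vchi ε' w) * G m ε' 1 := by
    simpa using G_succ_of_sym m w c hsym ε' 1
  have h3 : G m ε' 3 = ((c : GaussianInt) * vchi ε' w) * G m ε' 2 := by
    simpa using G_succ_of_sym m w c hsym ε' 2
  intro b
  fin_cases b
  · simp [G_zero_eq]
  · show G m ε' 1 = ((c : GaussianInt) * vchi ε' w) ^ 1 * vmoment (slice0 m) ε'
    rw [pow_one, h1, G_zero_eq]
  · show G m ε' 2 = ((c : GaussianInt) * vchi ε' w) ^ 2 * vmoment (slice0 m) ε'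
    rw [h2, h1, G_zero_eq]; ring
  · show G m ε' 3 = ((c : GaussianInt) * vchi ε' w) ^ 3 * vmoment (slice0 m) ε'
    rw [h3, h2, h1, G_zero_eq]; ring

/-- The ratio `ρ = c·i^{c_t + ε'·w}` of the moment `m̂(t, ε')`. [definition of this file] -/
def rho (c : ℤ) (t : Fin 3) (ε' : Eps n) (w : Letter n) : GaussianInt := (c : GaussianInt) * unitTab (coef t + expo ε' w)

/-- `i^{k·b} = (i^k)^b` on the table. -/
theorem unitTab_mul_eq_pow : ∀ k b : Fin 4, unitTab (k * b) = unitTab k ^ b.val := by decide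

/-- **THE MOMENT FORMULA:** `m̂(t, ε') = (Σ_{b<4} ρ^b)·q̂(ε')` with `ρ = c·i^{c_t + ε'·w}`. -/
theorem vmoment_of_sym (m : Letter (n + 1) → ℤ) (w : Letter n) (c : ℤ) (hsym : ∀ x, m (x + Fin.cons 1 w) = c * m x)
    (t : Fin 3) (ε' : Eps n) :
    vmoment m (Fin.cons t ε') = (∑ b : Fin 4, rho c t ε' w ^ b.val) * vmoment (slice0 m) ε' := by
  rw [vmoment_cons, Finset.sum_mul]
  refine Finset.sum_congr rfl (fun b _ => ?_)
  rw [G_eq_pow_mul m w c hsym ε' b, rho, unitTab_add, unitTab_mul_eq_pow, vchi]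
  ring

/-- `ρ⁴ = 1` when `c = ±1`. -/
theorem rho_pow_four (c : ℤ) (hc : c = 1 ∨ c = -1) (t : Fin 3) (ε' : Eps n) (w : Letter n) : rho c t ε' w ^ 4 = 1 := by
  have hu : ∀ u : Fin 4, unitTab u ^ 4 = 1 := by decide
  have hc4 : (c : GaussianInt) ^ 4 = 1 := by
    rcases hc with h | h <;> subst h <;> norm_num
  rw [rho, mul_pow, hu, hc4, one_mul]

/-- A fourth root of unity other than 1 has `1 + ρ + ρ² + ρ³ = 0` (`ℤ[i]` is a domain). -/
theorem geom_four_eq_zero (ρ : GaussianInt) (h4 : ρ ^ 4 = 1) (h1 : ρ ≠ 1) : (∑ b : Fin 4, ρ ^ b.val) = 0 := by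
  have key : (ρ - 1) * (∑ b : Fin 4, ρ ^ b.val) = 0 := by
    simp only [Fin.sum_univ_four, Fin.val_zero, Fin.val_one, Fin.val_two, show ((3 : Fin 4) : ℕ) = 3 from rfl]
    have : (ρ - 1) * (ρ ^ 0 + ρ ^ 1 + ρ ^ 2 + ρ ^ 3) = ρ ^ 4 - 1 := by ring
    rw [this, h4, sub_self]
  rcases mul_eq_zero.mp key with h | h
  · exact absurd (sub_eq_zero.mp h) h1
  · exact h

/-- The sum `Σ_{b<4} ρ^b` is `4` at `ρ = 1`. -/
theorem geom_four_one : (∑ b : Fin 4, (1 : GaussianInt) ^ b.val) = 4 := by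
  norm_num [Fin.sum_univ_four]

/-! ## §2 Purity, the Weil moment and the support of a design with a twisted symmetry -/

/-- Every pattern is `(ε 0, tail ε)`. -/
theorem eps_eq_cons (ε : Eps (n + 1)) : ε = Fin.cons (ε 0) (Fin.tail ε) := (Fin.cons_self_tail ε).symm

/-- **PURE IFF THE SLICE IS A RELAXED DESIGN:** under the twisted symmetry, all visible moments of `m` vanish iff for every visible
pattern `(t, ε')` either `ρ = c·i^{c_t + ε'·w} ≠ 1` (then the moment vanishes for free) or `q̂(ε') = 0`. -/
theorem pure_iff_of_sym (m : Letter (n + 1) → ℤ) (w : Letter n) (c : ℤ) (hc : c = 1 ∨ c = -1)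
    (hsym : ∀ x, m (x + Fin.cons 1 w) = c * m x) :
    (∀ ε : Eps (n + 1), ε ≠ plus → ε ≠ minus → vmoment m ε = 0) ↔
      (∀ (t : Fin 3) (ε' : Eps n), (Fin.cons t ε' : Eps (n + 1)) ≠ plus → (Fin.cons t ε' : Eps (n + 1)) ≠ minus →
        rho c t ε' w ≠ 1 ∨ vmoment (slice0 m) ε' = 0) := by
  constructor
  · intro hpure t ε' hp hm
    by_cases h1 : rho c t ε' w = 1
    · right
      have h := hpure _ hp hm
      rw [vmoment_of_sym m w c hsym, h1, geom_four_one] at h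
      rcases mul_eq_zero.mp h with h4 | h4
      · exact absurd h4 (by norm_num)
      · exact h4
    · exact Or.inl h1
  · intro hq ε hp hm
    rw [eps_eq_cons ε] at hp hm ⊢
    rw [vmoment_of_sym m w c hsym]
    rcases hq (ε 0) (Fin.tail ε) hp hm with h | h
    · rw [geom_four_eq_zero _ (rho_pow_four c hc _ _ _) h, zero_mul]
    · rw [h, mul_zero]

/-- **THE WEIL MOMENT:** if `c·i^{1 + Σ_k w_k} = 1` (i.e. `ρ = 1` at the all-plus pattern) then `m̂(+,…,+) = 4·q̂(+,…,+)`. -/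
theorem vmoment_plus_of_sym (m : Letter (n + 1) → ℤ) (w : Letter n) (c : ℤ)
    (hsym : ∀ x, m (x + Fin.cons 1 w) = c * m x) (h1 : rho c 1 (plus : Eps n) w = 1) :
    vmoment m plus = 4 * vmoment (slice0 m) plus := by
  rw [show (plus : Eps (n + 1)) = Fin.cons 1 plus from (cons_one_plus).symm, vmoment_of_sym m w c hsym, h1, geom_four_one]

/-- Consecutive slices have the same number of letters (the symmetry maps slice `b` onto slice `b + 1`). -/
theorem card_sliceSupp_succ_of_sym (m : Letter (n + 1) → ℤ) (w : Letter n) (c : ℤ) (hc : c = 1 ∨ c = -1)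
    (hsym : ∀ x, m (x + Fin.cons 1 w) = c * m x) (b : Fin 4) :
    (sliceSupp m (b + 1)).card = (sliceSupp m b).card := by
  have hc0 : c ≠ 0 := by rcases hc with h | h <;> simp [h]
  refine Finset.card_bij' (fun y _ => y - w) (fun y _ => y + w) ?_ ?_ ?_ ?_
  · intro y hy
    have h := (Finset.mem_filter.mp hy).2
    refine Finset.mem_filter.mpr ⟨Finset.mem_univ _, ?_⟩
    intro h0
    apply h
    have := hsym (Fin.cons b (y - w))
    rw [cons_add_cons_one, sub_add_cancel] at this
    rw [this, h0, mul_zero]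
  · intro y hy
    have h := (Finset.mem_filter.mp hy).2
    refine Finset.mem_filter.mpr ⟨Finset.mem_univ _, ?_⟩
    intro h0
    apply h
    have := hsym (Fin.cons b y)
    rw [cons_add_cons_one] at this
    rw [this] at h0
    rcases mul_eq_zero.mp h0 with h2 | h2
    · exact absurd h2 hc0
    · exact h2
  · intro y _
    exact sub_add_cancel y w
  · intro y _
    exact add_sub_cancel_right y w

/-- **THE SUPPORT:** `#supp m = 4·#supp q`. -/
theorem card_supp_of_sym (m : Letter (n + 1) → ℤ) (w : Letter n) (c : ℤ) (hc : c = 1 ∨ c = -1)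
    (hsym : ∀ x, m (x + Fin.cons 1 w) = c * m x) : (supp m).card = 4 * (supp (slice0 m)).card := by
  have h0 : (sliceSupp m 0).card = (supp (slice0 m)).card := rfl
  have h1 : (sliceSupp m 1).card = (sliceSupp m 0).card := by
    simpa using card_sliceSupp_succ_of_sym m w c hc hsym 0
  have h2 : (sliceSupp m 2).card = (sliceSupp m 1).card := by
    simpa using card_sliceSupp_succ_of_sym m w c hc hsym 1
  have h3 : (sliceSupp m 3).card = (sliceSupp m 2).card := by
    simpa using card_sliceSupp_succ_of_sym m w c hc hsym 2
  rw [← sum_card_slices m, Fin.sum_univ_four]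
  omega

/-! ## §3 The explicit twisted orbit of a relaxed design -/

/-- Sign table `c^j` for `j ∈ ℤ∕4` (with `c = ±1`, so that `c⁴ = 1` makes it well defined). [definition of this file] -/
def signPow (c : ℤ) (j : Fin 4) : ℤ := c ^ j.val

/-- **THE TWISTED ORBIT** of `q : (ℤ∕4)ⁿ → ℤ` under the translation `(1, w)` with sign `c`: `(j, y) ↦ c^j·q(y − j·w)`, written with
the four translates spelled out. [definition of this file] -/
def twistedOrbit (q : Letter n → ℤ) (w : Letter n) (c : ℤ) : Letter (n + 1) → ℤ := fun x =>
  signPow c (x 0) * (if x 0 = 0 then q (Fin.tail x) else if x 0 = 1 then q (Fin.tail x - w)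
    else if x 0 = 2 then q (Fin.tail x - w - w) else q (Fin.tail x - w - w - w))

/-- The slice of the twisted orbit is `q`. -/
theorem slice0_twistedOrbit (q : Letter n → ℤ) (w : Letter n) (c : ℤ) : slice0 (twistedOrbit q w c) = q := by
  funext y
  simp [slice0, twistedOrbit, signPow]

/-- The twisted orbit has the twisted symmetry `m(x + (1, w)) = c·m(x)` (for `c = ±1`). -/
theorem twistedOrbit_sym (q : Letter n → ℤ) (w : Letter n) (c : ℤ) (hc : c = 1 ∨ c = -1) :
    ∀ x, twistedOrbit q w c (x + Fin.cons 1 w) = c * twistedOrbit q w c x := by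
  intro x
  have hx : x = Fin.cons (x 0) (Fin.tail x) := (Fin.cons_self_tail x).symm
  have hw4 : Fin.tail x + w = Fin.tail x - w - w - w := by
    funext k
    simp only [Pi.sub_apply, Pi.add_apply]
    have : ∀ a b : Fin 4, a + b = a - b - b - b := by decide
    exact this _ _
  rw [hx, cons_add_cons_one]
  simp only [twistedOrbit, Fin.cons_zero, Fin.tail_cons]
  generalize Fin.tail x = t at hw4 ⊢
  generalize x 0 = b
  rcases hc with h | h <;> subst h <;> fin_cases b
  · simp [signPow]
  · simp [signPow]
  · simp [signPow, sub_sub]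
  · simp only [signPow, Fin.isValue]
    rw [hw4]
    simp [sub_sub]
  · simp [signPow]
  · simp [signPow]
  · simp [signPow, sub_sub]
  · simp only [signPow, Fin.isValue]
    rw [hw4]
    simp [sub_sub]

/-- **EVERY RELAXED DESIGN GIVES A PURE DESIGN ONE LEVEL UP WITH FOUR TIMES ITS SUPPORT.** If `c = ±1`, `c·i^{1 + Σw} = 1` (so that
the Weil pattern survives), `q̂(+,…,+) ≠ 0`, and `q̂(ε') = 0` for every visible `(t, ε')` with `ρ = 1`, then the twisted orbit of `q` is
a pure W-alive design on (ℤ∕4)ⁿ⁺¹ with `4·#supp q` letters. With s(n) witnesses for `q` this is weaker than LEMMA S's converse would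
be, but `q` need NOT be pure: the patterns with `ρ ≠ 1` are free — which is how 7 letters on (ℤ∕4)³ (s(3) = 14) give the 28-letter designs
on (ℤ∕4)⁴ and 24 letters on (ℤ∕4)⁴ (s(4) = 28) give 96 on (ℤ∕4)⁵. -/
theorem exists_pure_of_relaxed (q : Letter n → ℤ) (w : Letter n) (c : ℤ) (hc : c = 1 ∨ c = -1)
    (hplus : rho c 1 (plus : Eps n) w = 1) (halive : vmoment q plus ≠ 0)
    (hq : ∀ (t : Fin 3) (ε' : Eps n), (Fin.cons t ε' : Eps (n + 1)) ≠ plus → (Fin.cons t ε' : Eps (n + 1)) ≠ minus →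
      rho c t ε' w ≠ 1 ∨ vmoment q ε' = 0) :
    ∃ m : Letter (n + 1) → ℤ, (∀ ε : Eps (n + 1), ε ≠ plus → ε ≠ minus → vmoment m ε = 0) ∧
      vmoment m plus = 4 * vmoment q plus ∧ vmoment m plus ≠ 0 ∧ (supp m).card = 4 * (supp q).card := by
  refine ⟨twistedOrbit q w c, ?_, ?_, ?_, ?_⟩
  · rw [pure_iff_of_sym _ w c hc (twistedOrbit_sym q w c hc), slice0_twistedOrbit]
    exact hq
  · rw [vmoment_plus_of_sym _ w c (twistedOrbit_sym q w c hc) hplus, slice0_twistedOrbit]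
  · rw [vmoment_plus_of_sym _ w c (twistedOrbit_sym q w c hc) hplus, slice0_twistedOrbit]
    exact mul_ne_zero (by norm_num) halive
  · rw [card_supp_of_sym _ w c hc (twistedOrbit_sym q w c hc), slice0_twistedOrbit]

end Summit.Ventures.HSemireg.SignedWeilDesignN
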